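import Summits.CriticalPhenomena.CardyFormulaZ2.Theorems.CardySusyWardParafermionFamiliesToSLESixAnchorBulk
import Summits.CriticalPhenomena.CardyFormulaZ2.Theorems.ParafermionFamiliesToSLESix.Negative.CruxModuloBulkNondegenerate

/-!
# Line `strip-anchored-vertex-normalisation` — skeleton r7 (lead c6) for the crux
# `CardySusyWard.ParafermionFamiliesToSLESix` (stmt-CriticalPhenomena-10814): the residual IS the named fact `H`

Successor of skeleton r6 (lead c5: single stub `stub_anchorBulk : ¬ VertexVanishes anchorDomain anchorData`, the
normal form of the line's residual along the concrete anchor family).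

RESHAPE r7 (lead c6, 2026-08-17).  Two kernel-checked facts of the tree pin the residual of this crux to an EXISTING
named Literature proposition, and nothing stronger is consumed by any composition that closes the crux:

* `Negative.parafermionFamiliesToSLESix_iff_not_bulkNondegenerate_imp` (cdisprove, landed):
  `ParafermionFamiliesToSLESix ↔ (¬ H → SLE6LimitZ2AllDiscretisations)`, i.e. the crux AS TYPED is LITERALLY
  `H ∨ (the sub-problem's own conjecture leaf)`, with
  `H = Literature.Probability.LatticeModels.ParafermionBulkNondegenerate` (Duminil-Copin–Smirnov 2012, Conj. 8.7
  non-degeneracy at `q = 1`; Literature-prover verdict `open-problem`, `[status: open]`);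
* `bulkNondegenerate_of_not_vertexVanishes_anchorData` (lead c5, p147689): r6's stub implies `H`.

So the weakest statement closing the crux short of the summit conjecture is `H` itself, and r7 registers exactly that,
BY NAME, as its single stub `stub_bulkNondegenerate : ParafermionBulkNondegenerate` (the same idiom as r3/r4's
`stub_ikhlefPonsaingFirstPassage : IkhlefPonsaingFirstPassage`, discharged when that fact became a theorem).  The line's
own route to it is kept as recorded sufficient conditions (no `sorry`): r6 ⇒ r7 (`stub_bulkNondegenerate_of_anchorBulk`),
r5 ⇒ r7 (`…_of_layerSmall`), envelope ⇒ r7 (`…_of_UIE`, stmt-11387's junction), and the unfolded ∃-form of the anchor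
witness (`anchorBulk_iff_exists`, p149975).  `crux_iff_bulkNondegenerate_or_conjecture` records the disjunction.

Why the stub is not provable inside the line (leads c3–c6, strategist census `STRATEGY-CENSUS.md`): the wall side is a
THEOREM (`totalVertexSum_lower_anchorData : c δ^{-5/3} ≤ ‖Σ_{S_max} F_δ‖`, from the moment identity and Ikhlef–Ponsaing's
strip law), but localising that signed mass into a compact needs signed control of the boundary collar at relative
precision `δ^{1/12}` (unsigned totals scale as `N^{7/4}`, signed ones as `N^{5/3}`, in every geometry and for every
weighted half-CR Green identity), i.e. a sharp SIGNED bulk exponent of critical bond percolation on `ℤ²`; even the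
UNSIGNED shadow of `H` (`π₂(n) ≥ c n^{-1/3}` i.o. for the polychromatic two-arm probability on `ℤ²`) is open.  Lead c6's
two additional checks (unsigned localisation of the visit mass / monotonicity of visit probabilities towards the centre;
strip–rectangle coupling of the phased observable) end at the same two exponents (NOTES `## Census`).
-/

noncomputable section

namespace Summit.CriticalPhenomena.CardyFormulaZ2.Cruxes.ParafermionFamiliesToSLESix.StripAnchoredVertexNormalisation

open MeasureTheory Filter Set Metric
open scoped Topology BigOperators
open Literature.Probability.LatticeModels (DiscreteDobrushin MedialVertex Site medialPoint medialExploration IsCorner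
  zdGraph discreteDomainGraph ParafermionBulkNondegenerate)
open Literature.Probability.Percolation (bondPercolation half BondConfig)
open Literature.Probability.RandomPlanarGeometry (DobrushinDomain)
open Summit.CriticalPhenomena.CardyFormulaZ2.Theses.CardySusyWard
open Summit.CriticalPhenomena.CardyFormulaZ2.Theorems.ParafermionPrecompact.Negative (IsFamily VanishesOn)
open Summit.CriticalPhenomena.CardyFormulaZ2.Theorems.ParafermionFamiliesToSLESix.Negative
  (parafermionFamiliesToSLESix_iff_not_bulkNondegenerate_imp)
open Summit.CriticalPhenomena.CardyFormulaZ2.Cruxes.EdgePrecompact.QkzStripBoundaryArm (UniformInnerEnvelope)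
open Summit.CriticalPhenomena.CardyFormulaZ2.Theorems.ParafermionFamiliesToSLESix.StripAnchored
open Summit.CriticalPhenomena.CardyFormulaZ2.Theorems.ParafermionFamiliesToSLESix.StripAnchored.S5 (anchorDomain)

/-! ## The registered stub of r7 -/

/-- **stub_bulkNondegenerate (XL, OPEN — the named Literature fact `H`; the residual of the crux as typed).**
Bulk non-degeneracy of the spin-`1/3` vertex parafermionic observable of critical bond percolation on `ℤ²`: for SOME
Dobrushin domain, SOME admissible square-lattice discretisation family and SOME compact `K ⊆ Ω`, `sup_K ‖F_δ‖` is not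
`o(δ^{1/3})`.  By `parafermionFamiliesToSLESix_iff_not_bulkNondegenerate_imp` the crux as typed is `H ∨ SLE₆(ℤ²)`, so
this is the weakest stub closing it short of the summit conjecture; the line's witness for it is the anchor square along
`anchorData` (`stub_bulkNondegenerate_of_anchorBulk`). [cite: DuminilCopinSmirnov2012Lattice, Conjecture 8.7] -/
theorem stub_bulkNondegenerate : ParafermionBulkNondegenerate := by
  sorry

/-! ## Recorded sufficient conditions for the stub (the line's content; no `sorry`) -/

/-- **r6 ⇒ r7**: bulk non-vanishing along the concrete anchor family witnesses `H`
(`bulkNondegenerate_of_not_vertexVanishes_anchorData`, p147689). [cite: DuminilCopinSmirnov2012Lattice, Conjecture 8.7] -/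
theorem stub_bulkNondegenerate_of_anchorBulk (h : ¬ VertexVanishes anchorDomain anchorData) :
    ParafermionBulkNondegenerate :=
  bulkNondegenerate_of_not_vertexVanishes_anchorData h

/-- **r6 unfolded** (`anchorBulk_iff_exists`, p149975): the anchor witness in Literature vocabulary — on some compact
`K ⊆ Ω` of the anchor square, for some `ε > 0`, frequently as `δ → 0⁺` some medial vertex over `K` has
`ε δ^{1/3} < ‖vertexObs (anchorData δ) δ z‖`. [folklore] -/
theorem stub_bulkNondegenerate_of_anchorBulk_exists
    (h : ∃ K : Set ℂ, IsCompact K ∧ K ⊆ anchorDomain.carrier ∧ ∃ ε : ℝ, 0 < ε ∧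
      ∃ᶠ δ in 𝓝[>] (0:ℝ), ∃ z : MedialVertex, medialPoint δ z ∈ K ∧
        ε * δ ^ ((1:ℝ) / 3) < ‖vertexObs (anchorData δ) δ z‖) :
    ParafermionBulkNondegenerate :=
  bulkNondegenerate_of_not_vertexVanishes_anchorData (anchorBulk_iff_exists.2 h)

/-- **r5 ⇒ r7**: the layer estimate along every anchor family under vertex vanishing gives `H`
(`bulkNondegenerate_of_layerSmall`, p147689). [cite: DuminilCopinSmirnov2012Lattice, Conjecture 8.7] -/
theorem stub_bulkNondegenerate_of_layerSmall
    (hSmall : ∀ Λ : ℝ → DiscreteDobrushin, IsFamily anchorDomain Λ → VertexVanishes anchorDomain Λ → ∀ η > (0:ℝ),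
      ∃ᶠ δ in 𝓝[>] (0:ℝ), ‖totalVertexSum (Λ δ) δ‖ ≤ η * δ ^ (-(5:ℝ) / 3)) :
    ParafermionBulkNondegenerate :=
  bulkNondegenerate_of_layerSmall hSmall

/-- **The envelope route** (stmt-11387's junction closes this line at once): `UniformInnerEnvelope ⇒ H`, via
`not_vertexVanishes_anchorData_of_envelope` (from `stub_totalSmall_of_UIE`, p131326). [folklore] -/
theorem stub_bulkNondegenerate_of_UIE (hU : UniformInnerEnvelope) : ParafermionBulkNondegenerate :=
  bulkNondegenerate_of_not_vertexVanishes_anchorData (not_vertexVanishes_anchorData_of_envelope hU)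

/-! ## The shape of the crux as typed (no `sorry`) -/

/-- **The crux as typed is `H ∨ (the sub-problem's conjecture leaf)`** — read-back of the landed
`parafermionFamiliesToSLESix_iff_not_bulkNondegenerate_imp` as a disjunction (classically). [folklore] -/
theorem crux_iff_bulkNondegenerate_or_conjecture :
    ParafermionFamiliesToSLESix ↔
      (ParafermionBulkNondegenerate ∨ Summit.CriticalPhenomena.CardyFormulaZ2.SLE6LimitZ2AllDiscretisations) := by
  rw [parafermionFamiliesToSLESix_iff_not_bulkNondegenerate_imp]
  exact ⟨fun h => (em ParafermionBulkNondegenerate).imp_right h, fun h hn => h.resolve_left hn⟩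

/-- **`H` alone closes the crux as typed** (its second hypothesis `ParafermionPrecompact` is then contradictory).
[folklore] -/
theorem parafermionFamiliesToSLESix_of_bulkNondegenerate (hH : ParafermionBulkNondegenerate) :
    ParafermionFamiliesToSLESix :=
  parafermionFamiliesToSLESix_iff_not_bulkNondegenerate_imp.2 fun hn => (hn hH).elim

/-! ## The composition (sorry-free glue) -/

/-- **`ParafermionFamiliesToSLESix` from the registered stub — the skeleton theorem (concludes the crux BY NAME; no
`sorry` of its own).** -/
theorem ParafermionFamiliesToSLESix_of : ParafermionFamiliesToSLESix :=
  parafermionFamiliesToSLESix_of_bulkNondegenerate stub_bulkNondegenerate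

end Summit.CriticalPhenomena.CardyFormulaZ2.Cruxes.ParafermionFamiliesToSLESix.StripAnchoredVertexNormalisation

end
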